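import Summits.KontsevichZagierPeriods.KontsevichZagierPeriods.Theorems.RealOnePeriodRelations.Negative.Kit
import Summits.KontsevichZagierPeriods.KontsevichZagierPeriods.Theorems.StuffleInKZ.Negative.AlgebraicShadow
import Literature.NumberTheory.Transcendental.CurvePeriodsProofs
import Literature.NumberTheory.Transcendental.KZSemialgebraicComplex
import Literature.NumberTheory.Transcendental.KZPeriodsProofs
import Literature.NumberTheory.Transcendental.SemialgebraicMapsProofs
import Literature.NumberTheory.Transcendental.SemialgebraicDerivativeProofs
import Literature.NumberTheory.Transcendental.SemialgebraicLineDeriv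

/-!
# `RealOnePeriodRelations` (stmt-KontsevichZagierPeriods-10042), line `nash-retraction-thin-strip`,
# stub `stub_homotopyInvariance` — auxiliary file 1: move patterns and realisation representations

Helpers for the stub `stub_homotopyInvariance` (homotopy coherence in the move world):

* the vocabulary of the skeleton is kept INLINED: a path `e : [0,1] → ℂⁿ` is `ℚ`-semialgebraic
  if its realification `t ↦ (Re e, Im e)` is a semialgebraic map on `[0,1] ⊂ ℝ¹`, and `r`
  realises `a · ω` along `e` if `r = [∫_{(0,1)} Re(a · Σᵢ ωᵢ(e(t)) eᵢ′(t)) dt]`;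
* the elementary move patterns inside
  `M₁ = closure (domainAddRel ∪ integrandAddRel ∪ changeOfVariablesRel ∪ Green)`:
  representations with null domain or zero integrand lie in `M₁`, representations with the same
  domain and integrand agree modulo `M₁`, and a covering of the domain by two pieces with null
  overlap and null remainder splits a representation modulo `M₁` (rules 1a, 1b);
* realisation representations EXIST along every `ℚ`-semialgebraic `C¹` path: the real integrand
  `Re(a · Σᵢ ωᵢ(e) eᵢ′)` is `ℚ`-semialgebraic on `(0,1)` (real and imaginary parts of polynomials
  with algebraic coefficients, and of derivatives of semialgebraic functions,
  `IsSemialgebraicFunOn.hasDerivAt_isSemialgebraic_holds`) and integrable (continuous on `[0,1]`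
  after replacing `deriv` by the one-sided derivative).

References: M. Kontsevich, D. Zagier, *Periods* (2001), §1.1–1.2; J. Bochnak, M. Coste, M.-F. Roy,
*Real Algebraic Geometry* (1998), §2.2; S. Basu, R. Pollack, M.-F. Roy, *Algorithms in Real
Algebraic Geometry* (2006), Prop. 3.22.
-/

noncomputable section

open scoped BigOperators Topology
open Set MeasureTheory Filter
open Literature.NumberTheory.Transcendental Literature.NumberTheory.Transcendental.CurvePeriods
open Literature.ModelTheory.ExponentialFields (IsSemialgebraic isSemialgebraic_setOf_eval_nonneg)
open Summit.KontsevichZagierPeriods.SymplecticScissors.RealOnePeriodRelationsNegative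
  (greenSet M₁ unitDom isSemialgebraic_unitDom measurableSet_unitDom)
open Summit.KontsevichZagierPeriods.Theorems.StuffleInKZ.Negative.LogShadow (isSemialgebraic_Icc01)

namespace Summit.KontsevichZagierPeriods.SymplecticScissors.RealOnePeriodRelations.HomotopyInvariance

/-! ## Move patterns in `M₁` -/

/-- Rule 1a relations lie in `M₁`. [cite: KontsevichZagier2001, §1.2 rule (1)] -/
theorem domainAddRel_subset : KZ.domainAddRel ⊆ (M₁ : Set KZ.FormalRep) := fun _ hc =>
  AddSubgroup.subset_closure (Or.inl (Or.inl (Or.inl hc)))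

/-- Rule 1b relations lie in `M₁`. [cite: KontsevichZagier2001, §1.2 rule (1)] -/
theorem integrandAddRel_subset : KZ.integrandAddRel ⊆ (M₁ : Set KZ.FormalRep) := fun _ hc =>
  AddSubgroup.subset_closure (Or.inl (Or.inl (Or.inr hc)))

/-- Rule 2 relations lie in `M₁`. [cite: KontsevichZagier2001, §1.2 rule (2)] -/
theorem changeOfVariablesRel_subset : KZ.changeOfVariablesRel ⊆ (M₁ : Set KZ.FormalRep) :=
  fun _ hc => AddSubgroup.subset_closure (Or.inl (Or.inr hc))

/-- A representation with NULL domain lies in `M₁` (rule 1a with `σ = σ ∪ σ`, `vol (σ ∩ σ) = 0`).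
[cite: KontsevichZagier2001, §1.2 rule (1)] -/
theorem of_mem_of_volume_zero {n : ℕ} (r : KZ.IntegralRep n) (h : volume r.domain = 0) :
    KZ.of r ∈ M₁ := by
  have hrel : KZ.of r - KZ.of r - KZ.of r ∈ KZ.domainAddRel :=
    ⟨n, r, r, r, (union_self _).symm, by rwa [inter_self], fun _ _ => rfl, fun _ _ => rfl, rfl⟩
  have h' := domainAddRel_subset hrel
  rw [sub_self, zero_sub] at h'
  exact neg_mem_iff.mp h'

/-- A representation with ZERO integrand lies in `M₁` (rule 1b with `0 = 0 + 0`).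
[cite: KontsevichZagier2001, §1.2 rule (1)] -/
theorem of_mem_of_integrand_zero {n : ℕ} (r : KZ.IntegralRep n)
    (h : ∀ x ∈ r.domain, r.integrand x = 0) : KZ.of r ∈ M₁ := by
  have hrel : KZ.of r - KZ.of r - KZ.of r ∈ KZ.integrandAddRel := by
    refine ⟨n, r, r, r, rfl, rfl, fun x hx => ?_, rfl⟩
    show r.integrand x = r.integrand x + r.integrand x
    rw [h x hx, add_zero]
  have h' := integrandAddRel_subset hrel
  rw [sub_self, zero_sub] at h'
  exact neg_mem_iff.mp h'

/-- The zero representation on a semialgebraic domain exists. [cite: KontsevichZagier2001, §1.1] -/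
theorem exists_zeroRep {n : ℕ} (s : Set (Fin n → ℝ)) (hs : IsSemialgebraic ℚ s) :
    ∃ z : KZ.IntegralRep n, z.domain = s ∧ ∀ x, z.integrand x = 0 :=
  ⟨⟨s, fun _ => 0, hs, (isSemialgebraicFunOn_const_ratCast hs 0).congr fun _ _ => by simp,
    integrableOn_zero⟩, rfl, fun _ => rfl⟩

/-- Two representations with the same domain whose integrands agree there are congruent modulo
`M₁` (rule 1b with a zero summand). [cite: KontsevichZagier2001, §1.2 rule (1)] -/
theorem of_sub_of_mem_of_eqOn {n : ℕ} (r r' : KZ.IntegralRep n) (hd : r'.domain = r.domain)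
    (he : EqOn r.integrand r'.integrand r.domain) : KZ.of r - KZ.of r' ∈ M₁ := by
  obtain ⟨z, hzd, hz0⟩ := exists_zeroRep r.domain r.isSemialgebraic_domain
  have hrel : KZ.of r - KZ.of r' - KZ.of z ∈ KZ.integrandAddRel := by
    refine ⟨n, r, r', z, hd, hzd, fun x hx => ?_, rfl⟩
    show r.integrand x = r'.integrand x + z.integrand x
    rw [hz0, add_zero, he hx]
  have hz : KZ.of z ∈ M₁ := of_mem_of_integrand_zero _ fun x _ => hz0 x
  have := M₁.add_mem (integrandAddRel_subset hrel) hz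
  rwa [sub_add_cancel] at this

/-- **Splitting a domain** (rule 1a, twice): if the domains of `r₁`, `r₂` are pieces of the domain
of `r` with the same integrand, null overlap and null remainder, then `[r] − [r₁] − [r₂] ∈ M₁`.
[cite: KontsevichZagier2001, §1.2 rule (1)] -/
theorem of_sub_sub_mem_of_cover {n : ℕ} (r r₁ r₂ : KZ.IntegralRep n) (h₁ : r₁.domain ⊆ r.domain)
    (h₂ : r₂.domain ⊆ r.domain) (e₁ : EqOn r.integrand r₁.integrand r₁.domain)
    (e₂ : EqOn r.integrand r₂.integrand r₂.domain) (hnull : volume (r₁.domain ∩ r₂.domain) = 0)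
    (hrest : volume (r.domain \ (r₁.domain ∪ r₂.domain)) = 0) :
    KZ.of r - KZ.of r₁ - KZ.of r₂ ∈ M₁ := by
  have hU : IsSemialgebraic ℚ (r₁.domain ∪ r₂.domain) :=
    r₁.isSemialgebraic_domain.union r₂.isSemialgebraic_domain
  have hUr : r₁.domain ∪ r₂.domain ⊆ r.domain := union_subset h₁ h₂
  have hC : IsSemialgebraic ℚ (r.domain \ (r₁.domain ∪ r₂.domain)) :=
    r.isSemialgebraic_domain.diff hU
  set U := r.restrict _ hU hUr with hUdef
  set C := r.restrict _ hC Set.sdiff_subset with hCdef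
  have hrel₁ : KZ.of r - KZ.of U - KZ.of C ∈ KZ.domainAddRel := by
    refine ⟨n, r, U, C, ?_, ?_, fun _ _ => rfl, fun _ _ => rfl, rfl⟩
    · show r.domain = (r₁.domain ∪ r₂.domain) ∪ (r.domain \ (r₁.domain ∪ r₂.domain))
      rw [Set.union_sdiff_cancel hUr]
    · show volume ((r₁.domain ∪ r₂.domain) ∩ (r.domain \ (r₁.domain ∪ r₂.domain))) = 0
      rw [Set.inter_sdiff_self, measure_empty]
  have hrel₂ : KZ.of U - KZ.of r₁ - KZ.of r₂ ∈ KZ.domainAddRel :=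
    ⟨n, U, r₁, r₂, rfl, hnull, e₁, e₂, rfl⟩
  have hCm : KZ.of C ∈ M₁ := of_mem_of_volume_zero C hrest
  have := M₁.add_mem (M₁.add_mem (domainAddRel_subset hrel₁) (domainAddRel_subset hrel₂)) hCm
  convert this using 1
  abel

/-! ## Semialgebraic bookkeeping -/

/-- `(0,1) ⊆ [0,1]` in `ℝ¹`. [folklore] -/
theorem unitDom_subset_IccSet : unitDom ⊆ {z : Fin 1 → ℝ | z 0 ∈ Icc (0 : ℝ) 1} :=
  fun _ hz => Ioo_subset_Icc_self hz

/-- The coordinates of a semialgebraic path have semialgebraic real and imaginary parts.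
[cite: BochnakCosteRoy1998, §2.2] -/
theorem sa_re_im {n : ℕ} {e : ℝ → (Fin n → ℂ)}
    (h : IsSemialgebraicMapOn ℚ {z : Fin 1 → ℝ | z 0 ∈ Set.Icc (0 : ℝ) 1}
      (fun z => Fin.append (fun i => (e (z 0) i).re) (fun i => (e (z 0) i).im))) (i : Fin n) :
    IsSemialgebraicFunOn ℚ {z : Fin 1 → ℝ | z 0 ∈ Icc (0 : ℝ) 1} (fun z => (e (z 0) i).re) ∧
      IsSemialgebraicFunOn ℚ {z : Fin 1 → ℝ | z 0 ∈ Icc (0 : ℝ) 1} (fun z => (e (z 0) i).im) := by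
  have h' := (isSemialgebraicMapOn_iff_forall_holds isSemialgebraic_Icc01).mp h
  refine ⟨?_, ?_⟩
  · simpa only [Fin.append_left] using h' (Fin.castAdd n i)
  · simpa only [Fin.append_right] using h' (Fin.natAdd n i)

/-- One complex coordinate of a semialgebraic path, as a semialgebraic map `[0,1] → ℝ²`.
[cite: BochnakCosteRoy1998, §2.2] -/
theorem sa_coord {n : ℕ} {e : ℝ → (Fin n → ℂ)}
    (h : IsSemialgebraicMapOn ℚ {z : Fin 1 → ℝ | z 0 ∈ Set.Icc (0 : ℝ) 1}
      (fun z => Fin.append (fun i => (e (z 0) i).re) (fun i => (e (z 0) i).im))) (i : Fin n) :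
    IsSemialgebraicMapOn ℚ {z : Fin 1 → ℝ | z 0 ∈ Icc (0 : ℝ) 1}
      (fun z => ![(e (z 0) i).re, (e (z 0) i).im]) := by
  obtain ⟨hre, him⟩ := sa_re_im h i
  refine IsSemialgebraicMapOn.of_forall isSemialgebraic_Icc01 fun j => ?_
  fin_cases j
  · simpa using hre
  · simpa using him

/-- Finite sums of complex functions with semialgebraic real and imaginary parts.
[cite: BochnakCosteRoy1998, Prop. 2.2.6] -/
theorem re_im_finsetSum {m : ℕ} {s : Set (Fin m → ℝ)} (hs : IsSemialgebraic ℚ s) {ι : Type*}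
    (T : Finset ι) {F : ι → (Fin m → ℝ) → ℂ}
    (hF : ∀ i ∈ T, IsSemialgebraicFunOn ℚ s (fun x => (F i x).re) ∧
      IsSemialgebraicFunOn ℚ s (fun x => (F i x).im)) :
    IsSemialgebraicFunOn ℚ s (fun x => (∑ i ∈ T, F i x).re) ∧
      IsSemialgebraicFunOn ℚ s (fun x => (∑ i ∈ T, F i x).im) := by
  refine ⟨?_, ?_⟩
  · exact (IsSemialgebraicFunOn.fun_finsetSum T hs fun i hi => (hF i hi).1).congr fun x _ => by
      simp [Complex.re_sum]
  · exact (IsSemialgebraicFunOn.fun_finsetSum T hs fun i hi => (hF i hi).2).congr fun x _ => by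
      simp [Complex.im_sum]

/-- Finite products of complex functions with semialgebraic real and imaginary parts.
[cite: BochnakCosteRoy1998, Prop. 2.2.6] -/
theorem re_im_finsetProd {m : ℕ} {s : Set (Fin m → ℝ)} (hs : IsSemialgebraic ℚ s) {ι : Type*}
    (T : Finset ι) {F : ι → (Fin m → ℝ) → ℂ}
    (hF : ∀ i ∈ T, IsSemialgebraicFunOn ℚ s (fun x => (F i x).re) ∧
      IsSemialgebraicFunOn ℚ s (fun x => (F i x).im)) :
    IsSemialgebraicFunOn ℚ s (fun x => (∏ i ∈ T, F i x).re) ∧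
      IsSemialgebraicFunOn ℚ s (fun x => (∏ i ∈ T, F i x).im) := by
  classical
  induction T using Finset.induction_on with
  | empty =>
    refine ⟨?_, ?_⟩
    · simpa using isSemialgebraicFunOn_const_natCast hs 1
    · simpa using isSemialgebraicFunOn_const_natCast hs 0
  | insert a T ha ih =>
    have h := re_im_mul (hF a (Finset.mem_insert_self a T))
      (ih fun i hi => hF i (Finset.mem_insert_of_mem hi))
    refine ⟨h.1.congr fun x _ => ?_, h.2.congr fun x _ => ?_⟩
    · simp [Finset.prod_insert ha]
    · simp [Finset.prod_insert ha]

/-- **Polynomials with algebraic coefficients of semialgebraic complex functions** have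
semialgebraic real and imaginary parts (`eval = Σ_d coeff_d · Π xᵢ^{dᵢ}`).
[cite: KontsevichZagier2001, §1.1] -/
theorem re_im_eval {m n : ℕ} {s : Set (Fin m → ℝ)} (hs : IsSemialgebraic ℚ s)
    {F : (Fin m → ℝ) → (Fin n → ℂ)}
    (hF : ∀ i, IsSemialgebraicFunOn ℚ s (fun x => (F x i).re) ∧
      IsSemialgebraicFunOn ℚ s (fun x => (F x i).im))
    {P : MvPolynomial (Fin n) ℂ} (hP : HasAlgCoeffs P) :
    IsSemialgebraicFunOn ℚ s (fun x => (MvPolynomial.eval (F x) P).re) ∧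
      IsSemialgebraicFunOn ℚ s (fun x => (MvPolynomial.eval (F x) P).im) := by
  have key : ∀ x, MvPolynomial.eval (F x) P = ∑ d ∈ P.support, P.coeff d * ∏ i, F x i ^ d i :=
    fun x => MvPolynomial.eval_eq' (F x) P
  have h := re_im_finsetSum hs P.support (F := fun d x => P.coeff d * ∏ i, F x i ^ d i)
    fun d _ => re_im_mul (re_im_const hs (isAlgebraic_re_im (hP d)).1 (isAlgebraic_re_im (hP d)).2)
      (re_im_finsetProd hs Finset.univ (F := fun i x => F x i ^ d i)
        fun i _ => re_im_pow hs (hF i) (d i))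
  refine ⟨h.1.congr fun x _ => ?_, h.2.congr fun x _ => ?_⟩
  · simp only [key]
  · simp only [key]

/-! ## Realisation representations along semialgebraic `C¹` paths -/

/-- At interior times a `C¹` map on `[0,1]` has differentiable coordinates. [folklore] -/
theorem hasDerivAt_coord {n : ℕ} {e : ℝ → (Fin n → ℂ)} (he : ContDiffOn ℝ 1 e (Icc 0 1))
    {t : ℝ} (ht : t ∈ Ioo (0 : ℝ) 1) (i : Fin n) :
    HasDerivAt (fun u => e u i) (deriv (fun u => e u i) t) t :=
  (((contDiffOn_pi.1 he i).differentiableOn one_ne_zero).differentiableAt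
    (Icc_mem_nhds ht.1 ht.2)).hasDerivAt

/-- **Derivatives of semialgebraic paths are semialgebraic**: the real and imaginary parts of
`t ↦ eᵢ′(t)` are `ℚ`-semialgebraic on `(0,1)`. [cite: BasuPollackRoy2006, Prop. 3.22] -/
theorem re_im_deriv {n : ℕ} {e : ℝ → (Fin n → ℂ)} (he : ContDiffOn ℝ 1 e (Icc 0 1))
    (hsa : IsSemialgebraicMapOn ℚ {z : Fin 1 → ℝ | z 0 ∈ Set.Icc (0 : ℝ) 1}
      (fun z => Fin.append (fun i => (e (z 0) i).re) (fun i => (e (z 0) i).im))) (i : Fin n) :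
    IsSemialgebraicFunOn ℚ unitDom (fun z => (deriv (fun u => e u i) (z 0)).re) ∧
      IsSemialgebraicFunOn ℚ unitDom (fun z => (deriv (fun u => e u i) (z 0)).im) := by
  obtain ⟨hre, him⟩ := sa_re_im hsa i
  refine ⟨?_, ?_⟩
  · refine IsSemialgebraicFunOn.hasDerivAt_isSemialgebraic_holds 0 1 (fun t => (e t i).re)
      (fun t => (deriv (fun u => e u i) t).re) zero_lt_one
      (hre.mono unitDom_subset_IccSet isSemialgebraic_unitDom) fun x hx => ?_
    exact Complex.reCLM.hasFDerivAt.comp_hasDerivAt x (hasDerivAt_coord he hx i)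
  · refine IsSemialgebraicFunOn.hasDerivAt_isSemialgebraic_holds 0 1 (fun t => (e t i).im)
      (fun t => (deriv (fun u => e u i) t).im) zero_lt_one
      (him.mono unitDom_subset_IccSet isSemialgebraic_unitDom) fun x hx => ?_
    exact Complex.imCLM.hasFDerivAt.comp_hasDerivAt x (hasDerivAt_coord he hx i)

/-- **The real period integrand is `ℚ`-semialgebraic on `(0,1)`.**
[cite: KontsevichZagier2001, §1.1] -/
theorem isSemialgebraicFunOn_integrand {n : ℕ} (ω : Fin n → MvPolynomial (Fin n) ℂ)
    (hω : ∀ i, HasAlgCoeffs (ω i)) {a : ℂ} (ha : IsAlgebraic ℚ a) {e : ℝ → (Fin n → ℂ)}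
    (he : ContDiffOn ℝ 1 e (Icc 0 1))
    (hsa : IsSemialgebraicMapOn ℚ {z : Fin 1 → ℝ | z 0 ∈ Set.Icc (0 : ℝ) 1}
      (fun z => Fin.append (fun i => (e (z 0) i).re) (fun i => (e (z 0) i).im))) :
    IsSemialgebraicFunOn ℚ unitDom (fun z =>
      (a * ∑ i, MvPolynomial.eval (e (z 0)) (ω i) * deriv (fun u => e u i) (z 0)).re) := by
  have hco : ∀ i, IsSemialgebraicFunOn ℚ unitDom (fun z => (e (z 0) i).re) ∧
      IsSemialgebraicFunOn ℚ unitDom (fun z => (e (z 0) i).im) := fun i =>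
    ⟨(sa_re_im hsa i).1.mono unitDom_subset_IccSet isSemialgebraic_unitDom,
      (sa_re_im hsa i).2.mono unitDom_subset_IccSet isSemialgebraic_unitDom⟩
  have hsum := re_im_finsetSum isSemialgebraic_unitDom Finset.univ
    (F := fun i z => MvPolynomial.eval (e (z 0)) (ω i) * deriv (fun u => e u i) (z 0))
    fun i _ => re_im_mul (re_im_eval isSemialgebraic_unitDom (F := fun z => e (z 0)) hco (hω i))
      (re_im_deriv he hsa i)
  exact (re_im_mul (re_im_const isSemialgebraic_unitDom (isAlgebraic_re_im ha).1
    (isAlgebraic_re_im ha).2) hsum).1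

/-- The one-sided real period integrand is continuous on `[0,1]`. [folklore] -/
theorem continuousOn_integrandWithin {n : ℕ} (ω : Fin n → MvPolynomial (Fin n) ℂ) (a : ℂ)
    {e : ℝ → (Fin n → ℂ)} (he : ContDiffOn ℝ 1 e (Icc 0 1)) :
    ContinuousOn (fun t => (a * ∑ i, MvPolynomial.eval (e t) (ω i) *
      derivWithin (fun u => e u i) (Icc 0 1) t).re) (Icc 0 1) := by
  refine Complex.continuous_re.comp_continuousOn (continuousOn_const.mul ?_)
  refine continuousOn_finsetSum _ fun i _ => ?_
  exact ((MvPolynomial.continuous_eval (ω i)).comp_continuousOn he.continuousOn).mul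
    ((contDiffOn_pi.1 he i).continuousOn_derivWithin (uniqueDiffOn_Icc zero_lt_one) le_rfl)

/-- `[0,1] ⊂ ℝ¹` is compact. [folklore] -/
theorem isCompact_IccSet : IsCompact {z : Fin 1 → ℝ | z 0 ∈ Icc (0 : ℝ) 1} := by
  have : {z : Fin 1 → ℝ | z 0 ∈ Icc (0 : ℝ) 1} = (fun t : ℝ => fun _ : Fin 1 => t) '' Icc 0 1 := by
    ext z
    constructor
    · intro hz
      exact ⟨z 0, hz, funext fun i => by rw [Subsingleton.elim i 0]⟩
    · rintro ⟨t, ht, rfl⟩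
      exact ht
  rw [this]
  exact isCompact_Icc.image (continuous_pi fun _ => continuous_id)

/-- **The real period integrand is integrable on `(0,1)`** (it agrees there with a function
continuous on the compact `[0,1]`). [folklore] -/
theorem integrableOn_integrand {n : ℕ} (ω : Fin n → MvPolynomial (Fin n) ℂ) (a : ℂ)
    {e : ℝ → (Fin n → ℂ)} (he : ContDiffOn ℝ 1 e (Icc 0 1)) :
    IntegrableOn (fun z : Fin 1 → ℝ =>
      (a * ∑ i, MvPolynomial.eval (e (z 0)) (ω i) * deriv (fun u => e u i) (z 0)).re) unitDom := by
  have hG := continuousOn_integrandWithin ω a he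
  have hG' : ContinuousOn (fun z : Fin 1 → ℝ => (a * ∑ i, MvPolynomial.eval (e (z 0)) (ω i) *
      derivWithin (fun u => e u i) (Icc 0 1) (z 0)).re) {z : Fin 1 → ℝ | z 0 ∈ Icc (0 : ℝ) 1} :=
    hG.comp (continuous_apply 0).continuousOn fun _ hz => hz
  refine ((hG'.integrableOn_compact isCompact_IccSet).mono_set unitDom_subset_IccSet).congr_fun
    (fun z hz => ?_) measurableSet_unitDom
  have hz' : z 0 ∈ Ioo (0 : ℝ) 1 := hz
  show (a * ∑ i, MvPolynomial.eval (e (z 0)) (ω i) *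
      derivWithin (fun u => e u i) (Icc 0 1) (z 0)).re = _
  congr 2
  refine Finset.sum_congr rfl fun i _ => ?_
  rw [derivWithin_of_mem_nhds (Icc_mem_nhds hz'.1 hz'.2)]

/-- **Realisations exist** along semialgebraic `C¹` paths. [cite: KontsevichZagier2001, §1.1] -/
theorem exists_realisesRep {n : ℕ} (ω : Fin n → MvPolynomial (Fin n) ℂ)
    (hω : ∀ i, HasAlgCoeffs (ω i)) {a : ℂ} (ha : IsAlgebraic ℚ a) {e : ℝ → (Fin n → ℂ)}
    (he : ContDiffOn ℝ 1 e (Icc 0 1))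
    (hsa : IsSemialgebraicMapOn ℚ {z : Fin 1 → ℝ | z 0 ∈ Set.Icc (0 : ℝ) 1}
      (fun z => Fin.append (fun i => (e (z 0) i).re) (fun i => (e (z 0) i).im))) :
    ∃ r : KZ.IntegralRep 1, r.domain = {z | z 0 ∈ Set.Ioo (0 : ℝ) 1} ∧ ∀ z ∈ r.domain, r.integrand z =
      (a * ∑ i, MvPolynomial.eval (e (z 0)) (ω i) * deriv (fun u => e u i) (z 0)).re :=
  ⟨⟨unitDom, fun z => (a * ∑ i, MvPolynomial.eval (e (z 0)) (ω i) * deriv (fun u => e u i) (z 0)).re,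
    isSemialgebraic_unitDom, isSemialgebraicFunOn_integrand ω hω ha he hsa,
    integrableOn_integrand ω a he⟩, rfl, fun _ _ => rfl⟩

/-- A realisation along a CONSTANT path has zero integrand, hence lies in `M₁`.
[cite: KontsevichZagier2001, §1.2 rule (1)] -/
theorem of_mem_of_realisesRep_const {n : ℕ} {r : KZ.IntegralRep 1} {a : ℂ}
    {ω : Fin n → MvPolynomial (Fin n) ℂ} {e : ℝ → (Fin n → ℂ)} {P : Fin n → ℂ} (hP : ∀ u, e u = P)
    (hr : r.domain = {z | z 0 ∈ Set.Ioo (0 : ℝ) 1} ∧ ∀ z ∈ r.domain, r.integrand z =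
      (a * ∑ i, MvPolynomial.eval (e (z 0)) (ω i) * deriv (fun u => e u i) (z 0)).re) :
    KZ.of r ∈ M₁ := by
  have he : e = fun _ => P := funext hP
  subst he
  refine of_mem_of_integrand_zero r fun z hz => ?_
  rw [hr.2 z hz]
  simp

/-- Two realisations of the same data are congruent modulo `M₁`; more generally so are
realisations along two paths which agree on `[0,1]`. [cite: KontsevichZagier2001, §1.2 rule (1)] -/
theorem of_sub_of_mem_of_realisesRep {n : ℕ} {r r' : KZ.IntegralRep 1} {a : ℂ}
    {ω : Fin n → MvPolynomial (Fin n) ℂ} {e e' : ℝ → (Fin n → ℂ)}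
    (hr : r.domain = {z | z 0 ∈ Set.Ioo (0 : ℝ) 1} ∧ ∀ z ∈ r.domain, r.integrand z =
      (a * ∑ i, MvPolynomial.eval (e (z 0)) (ω i) * deriv (fun u => e u i) (z 0)).re)
    (hr' : r'.domain = {z | z 0 ∈ Set.Ioo (0 : ℝ) 1} ∧ ∀ z ∈ r'.domain, r'.integrand z =
      (a * ∑ i, MvPolynomial.eval (e' (z 0)) (ω i) * deriv (fun u => e' u i) (z 0)).re)
    (hee' : ∀ t ∈ Icc (0 : ℝ) 1, e t = e' t) :
    KZ.of r - KZ.of r' ∈ M₁ := by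
  refine of_sub_of_mem_of_eqOn r r' (hr'.1.trans hr.1.symm) fun z hz => ?_
  have hz' : z 0 ∈ Ioo (0 : ℝ) 1 := by
    have := hz; rw [hr.1] at this; exact this
  rw [hr.2 z hz, hr'.2 z (by rw [hr'.1, ← hr.1]; exact hz), hee' _ (Ioo_subset_Icc_self hz')]
  congr 2
  refine Finset.sum_congr rfl fun i _ => ?_
  congr 1
  refine Filter.EventuallyEq.deriv_eq ?_
  filter_upwards [Icc_mem_nhds hz'.1 hz'.2] with u hu
  rw [hee' u hu]

end Summit.KontsevichZagierPeriods.SymplecticScissors.RealOnePeriodRelations.HomotopyInvariance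

namespace Summit.KontsevichZagierPeriods.SymplecticScissors.RealOnePeriodRelations

/-- **Registered anchor `helper_homotopyInvariance_1` (REALISATIONS EXIST).** Along every
`ℚ`-semialgebraic `C¹` path `e : [0,1] → ℂⁿ`, for every polynomial form `ω` over `ℚ̄` and algebraic
scalar `a`, `t ↦ Re(a · Σᵢ ωᵢ(e(t)) eᵢ′(t))` on `(0,1)` is the integrand of a one-dimensional KZ
representation. [cite: KontsevichZagier2001, §1.1] -/
theorem helper_homotopyInvariance_1 : ∀ (n : ℕ) (ω : Fin n → MvPolynomial (Fin n) ℂ), (∀ i, HasAlgCoeffs (ω i)) → ∀ (a : ℂ), IsAlgebraic ℚ a → ∀ (e : ℝ → (Fin n → ℂ)), ContDiffOn ℝ 1 e (Set.Icc 0 1) → IsSemialgebraicMapOn ℚ {z : Fin 1 → ℝ | z 0 ∈ Set.Icc (0 : ℝ) 1} (fun z => Fin.append (fun i => (e (z 0) i).re) (fun i => (e (z 0) i).im)) → ∃ r : KZ.IntegralRep 1, r.domain = {z | z 0 ∈ Set.Ioo (0 : ℝ) 1} ∧ ∀ z ∈ r.domain, r.integrand z = (a * ∑ i, MvPolynomial.eval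 (e (z 0)) (ω i) * deriv (fun u => e u i) (z 0)).re :=
  fun _ ω hω _ ha _ he hsa => HomotopyInvariance.exists_realisesRep ω hω ha he hsa

end Summit.KontsevichZagierPeriods.SymplecticScissors.RealOnePeriodRelations

end
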